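import Mathlib
import HarnessLib
import Summits.AtomisticToContinuum.FouriersLaw.Theses.JunctionLocality
import Summits.AtomisticToContinuum.FouriersLaw.Theorems.JunctionLocalitySuperadditiveResistanceDeviceLiouville
import Summits.AtomisticToContinuum.FouriersLaw.Theorems.JunctionLocalitySuperadditiveResistancePlainAdjoint
import Literature.MathematicalPhysics.KineticTheory.PhaseSpacePoisson

/-!
# Forward fields of the γ-probed device, V: the operator `λ − (σ X_H + c S_B)` on `C_c^∞ ⊂ L²(μ_T)`
(helper toward stub `stub_deviceForwardFields` of line `floating-probe-bypass-laplacian`,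
crux stmt-AtomisticToContinuum-11748; Part V, see Part I `…StubDeviceForwardFieldsAux1` for the
overview)

Elementary `L²(μ_T)` bookkeeping for the resolvent construction of Part VI (no definitions):
* linearity of `X_H`, `S_B` on `C²` (`liouvilleOp_add'`, `liouvilleOp_const_mul`, `bathOp_add'`,
  `bathOp_const_mul`), compact support and continuity of `σ X_H f + c S_B f + κ f` for
  `f ∈ C²_c` (`hasCompactSupport_genOp`, `continuous_genOp`), `L²` membership of compactly supported continuous functions for a
  finite measure (`memLp_two_of_hasCompactSupport`);
* the `L²(μ)` inner product of `toLp` representatives as an integral (`inner_toLp_left`,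
  `inner_toLp_toLp`, `norm_toLp_sq`);
* **dissipativity** `integral_genOp_mul_self_nonpos`: `∫ (σ X_H ψ + c S_B ψ) ψ dμ_T ≤ 0` for
  `ψ ∈ C²_c`, `c ≥ 0`, `B ≥ 0`, `T > 0` (`X_H` is `μ_T`-antisymmetric, `∫ (S_i ψ) ψ dμ_T =
  −T ∫ (∂_{p_i} ψ)² dμ_T`), hence the coercivity `λ ∫ ψ² dμ_T ≤ ∫ (λψ − σ X_H ψ − c S_B ψ) ψ dμ_T`
  (`integral_resolventOp_mul_self_ge`).
Axioms: `propext`, `Classical.choice`, `Quot.sound`.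
-/

noncomputable section

open MeasureTheory Filter Topology ProbabilityTheory
open scoped ContDiff NNReal InnerProductSpace
open Literature.MathematicalPhysics.KineticTheory.HeatConduction
open Summit.AtomisticToContinuum.FouriersLaw.Theorems.SuperadditiveResistance.DeviceLiouville

namespace Summit.AtomisticToContinuum.FouriersLaw.Cruxes.SuperadditiveResistance.FloatingProbeBypassLaplacian

/-! ## Linearity of `X_H` and `S_B` on `C²` -/

section Linear

variable (P : OscillatorChain) {L : ℕ}

/-- `X_H (f + g) = X_H f + X_H g` for differentiable `f, g`. [folklore] -/
theorem liouvilleOp_add' {f g : PhaseSpace L → ℝ} (hf : Differentiable ℝ f)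
    (hg : Differentiable ℝ g) (x : PhaseSpace L) :
    liouvilleOp P L (f + g) x = liouvilleOp P L f x + liouvilleOp P L g x := by
  unfold liouvilleOp
  rw [← Finset.sum_add_distrib]
  refine Finset.sum_congr rfl fun i _ => ?_
  rw [partialQ_add hf hg, partialP_add hf hg]
  ring

/-- `X_H (a f) = a X_H f`. [folklore] -/
theorem liouvilleOp_const_mul (a : ℝ) (f : PhaseSpace L → ℝ) (x : PhaseSpace L) :
    liouvilleOp P L (fun y => a * f y) x = a * liouvilleOp P L f x := by
  unfold liouvilleOp
  rw [Finset.mul_sum]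
  refine Finset.sum_congr rfl fun i _ => ?_
  rw [partialQ_const_mul, partialP_const_mul]
  ring

variable {P}

/-- `S_B (f + g) = S_B f + S_B g` for `f, g ∈ C²`. [folklore] -/
theorem bathOp_add' {f g : PhaseSpace L → ℝ} (hf : ContDiff ℝ 2 f) (hg : ContDiff ℝ 2 g)
    (B : Fin L → ℝ) (T : ℝ) (x : PhaseSpace L) :
    bathOp L B T (f + g) x = bathOp L B T f x + bathOp L B T g x := by
  have hfd := hf.differentiable two_ne_zero
  have hgd := hg.differentiable two_ne_zero
  unfold bathOp
  rw [← Finset.sum_add_distrib]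
  refine Finset.sum_congr rfl fun i _ => ?_
  have h1 : partialP i (f + g) = partialP i f + partialP i g :=
    funext fun y => partialP_add hfd hgd i y
  rw [h1, partialP_add (differentiable_partialP_of_contDiff_two hf i)
    (differentiable_partialP_of_contDiff_two hg i)]
  simp only [Pi.add_apply]
  ring

/-- `S_B (a f) = a S_B f`. [folklore] -/
theorem bathOp_const_mul (a : ℝ) (f : PhaseSpace L → ℝ) (B : Fin L → ℝ) (T : ℝ) (x : PhaseSpace L) :
    bathOp L B T (fun y => a * f y) x = a * bathOp L B T f x := by
  unfold bathOp
  rw [Finset.mul_sum]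
  refine Finset.sum_congr rfl fun i _ => ?_
  have h1 : partialP i (fun y => a * f y) = fun y => a * partialP i f y :=
    funext fun y => partialP_const_mul a f i y
  rw [h1, partialP_const_mul]
  ring

/-- `σ X_H f + c S_B f + κ f` has compact support for `f ∈ C²_c`. [folklore] -/
theorem hasCompactSupport_genOp (L : ℕ) (σ c κ : ℝ) (B : Fin L → ℝ) (T : ℝ) {f : PhaseSpace L → ℝ}
    (hf : ContDiff ℝ 2 f) (hfc : HasCompactSupport f) :
    HasCompactSupport (fun x => σ * liouvilleOp P L f x + c * bathOp L B T f x + κ * f x) := by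
  have hfd := hf.differentiable two_ne_zero
  have hPs : ∀ i, HasCompactSupport (partialP i f) := fun i => hasCompactSupport_partialP hfd hfc i
  have hQs : ∀ i, HasCompactSupport (partialQ i f) := fun i => hasCompactSupport_partialQ hfd hfc i
  have hPPs : ∀ i, HasCompactSupport (partialP i (partialP i f)) := fun i =>
    hasCompactSupport_partialP (differentiable_partialP_of_contDiff_two hf i) (hPs i) i
  have hX : HasCompactSupport (liouvilleOp P L f) := by
    have : liouvilleOp P L f = ∑ i, fun x : PhaseSpace L => (x.2 i * partialQ i f x -
        partialQ i (P.hamiltonian L) x * partialP i f x) := by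
      funext x
      simp only [liouvilleOp, Finset.sum_apply]
    rw [this]
    exact HasCompactSupport.finset_sum fun i _ =>
      ((hQs i).mul_left (f := fun x : PhaseSpace L => x.2 i)).sub ((hPs i).mul_left)
  have hS : HasCompactSupport (bathOp L B T f) := by
    have : bathOp L B T f = ∑ i, fun x : PhaseSpace L => B i * (T * partialP i (partialP i f) x -
        x.2 i * partialP i f x) := by
      funext x
      simp only [bathOp, Finset.sum_apply]
    rw [this]
    exact HasCompactSupport.finset_sum fun i _ =>
      (((hPPs i).mul_left).sub ((hPs i).mul_left)).mul_left
  exact ((hX.mul_left).add (hS.mul_left)).add (hfc.mul_left)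

/-- `σ X_H f + c S_B f + κ f` is continuous for `f ∈ C²` (`C¹` potentials). [folklore] -/
theorem continuous_genOp (hU : ContDiff ℝ 1 P.U) (hV : ContDiff ℝ 1 P.V) (L : ℕ) (σ c κ : ℝ)
    (B : Fin L → ℝ) (T : ℝ) {f : PhaseSpace L → ℝ} (hf : ContDiff ℝ 2 f) :
    Continuous (fun x => σ * liouvilleOp P L f x + c * bathOp L B T f x + κ * f x) :=
  ((continuous_const.mul (continuous_liouvilleOp P hU hV (hf.of_le (by norm_num)))).add
    (continuous_const.mul (continuous_bathOp hf _ _))).add (continuous_const.mul hf.continuous)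

end Linear

/-! ## `L²` bookkeeping -/

section LTwo

variable {α : Type*} [MeasurableSpace α] {μ : Measure α}

/-- The `L²(μ)` inner product of a `toLp` representative with an `L²` class is the integral of the
product. [folklore] -/
theorem inner_toLp_left {f : α → ℝ} (hf : MemLp f 2 μ) (v : Lp ℝ 2 μ) :
    ⟪hf.toLp f, v⟫_ℝ = ∫ x, f x * v x ∂μ := by
  rw [MeasureTheory.L2.inner_def]
  refine integral_congr_ae ?_
  filter_upwards [hf.coeFn_toLp] with x hx
  rw [hx]
  simp [mul_comm]

/-- The `L²(μ)` inner product of two `toLp` representatives. [folklore] -/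
theorem inner_toLp_toLp {f g : α → ℝ} (hf : MemLp f 2 μ) (hg : MemLp g 2 μ) :
    ⟪hf.toLp f, hg.toLp g⟫_ℝ = ∫ x, f x * g x ∂μ := by
  rw [inner_toLp_left]
  refine integral_congr_ae ?_
  filter_upwards [hg.coeFn_toLp] with x hx
  rw [hx]

/-- `‖toLp f‖² = ∫ f²`. [folklore] -/
theorem norm_toLp_sq {f : α → ℝ} (hf : MemLp f 2 μ) : ‖hf.toLp f‖ ^ 2 = ∫ x, f x ^ 2 ∂μ := by
  rw [← real_inner_self_eq_norm_sq, inner_toLp_toLp]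
  exact integral_congr_ae (ae_of_all _ fun x => by ring)

/-- Compactly supported continuous functions are in `L²` of a finite measure. [folklore] -/
theorem memLp_two_of_hasCompactSupport {E : Type*} [TopologicalSpace E] [MeasurableSpace E]
    [OpensMeasurableSpace E] (ν : Measure E) [IsFiniteMeasure ν] {f : E → ℝ} (hf : Continuous f)
    (hfc : HasCompactSupport f) : MemLp f 2 ν :=
  (hf.memLp_top_of_hasCompactSupport hfc ν).mono_exponent le_top

end LTwo

/-! ## Dissipativity of `σ X_H + c S_B` on `C²_c` in `L²(μ_T)` -/

section Dissipative

variable (P : OscillatorChain) {L : ℕ}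

/-- **`∫ (σ X_H ψ + c S_B ψ) ψ ρ_T ≤ 0`** for `ψ ∈ C²_c`, `c ≥ 0`, `B ≥ 0`, `T > 0` (Lebesgue
form): `∫ (X_H ψ) ψ ρ_T = 0` and `∫ (S_i ψ) ψ ρ_T = −T ∫ (∂_{p_i} ψ)² ρ_T`. [folklore] -/
theorem integral_genOp_mul_self_density_nonpos (hU : ContDiff ℝ 1 P.U) (hV : ContDiff ℝ 1 P.V)
    (L : ℕ) {T : ℝ} (hT : 0 < T) (σ : ℝ) {c : ℝ} (hc : 0 ≤ c) {B : Fin L → ℝ} (hB : ∀ i, 0 ≤ B i)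
    {f : PhaseSpace L → ℝ} (hf : ContDiff ℝ 2 f) (hfc : HasCompactSupport f) :
    ∫ x, (σ * liouvilleOp P L f x + c * bathOp L B T f x) * (f x * P.gibbsDensity L T x) ≤ 0 := by
  have hf1 : ContDiff ℝ 1 f := hf.of_le (by norm_num)
  have hfd := hf.differentiable two_ne_zero
  have hρc : Continuous (P.gibbsDensity L T) :=
    P.continuous_gibbsDensity hU.continuous hV.continuous L T
  have hρpos : ∀ x, 0 < P.gibbsDensity L T x := fun x => P.gibbsDensity_pos L T x
  have hfP1 : ∀ i, ContDiff ℝ 1 (partialP i f) := fun i => contDiff_partialP hf (by norm_num) i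
  have hPs : ∀ i, HasCompactSupport (partialP i f) := fun i => hasCompactSupport_partialP hfd hfc i
  have hPPs : ∀ i, HasCompactSupport (partialP i (partialP i f)) := fun i =>
    hasCompactSupport_partialP ((hfP1 i).differentiable one_ne_zero) (hPs i) i
  have hPc : ∀ i, Continuous (partialP i f) := fun i => (hfP1 i).continuous
  have hPPc : ∀ i, Continuous (partialP i (partialP i f)) := fun i =>
    continuous_partialP (hfP1 i) one_ne_zero i
  -- the Liouville part vanishes
  have hX : ∫ x, liouvilleOp P L f x * (f x * P.gibbsDensity L T x) = 0 := by
    have e := integral_liouvilleOp_mul P hU hV L T hf1 hfc hf1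
    have e2 : ∫ x, f x * (liouvilleOp P L f x * P.gibbsDensity L T x) =
        ∫ x, liouvilleOp P L f x * (f x * P.gibbsDensity L T x) :=
      integral_congr_ae (ae_of_all _ fun x => by ring)
    rw [e2] at e
    linarith
  -- the thermostat part is a negative carré du champ
  have iS : ∀ i, Integrable (fun x => c * B i *
      ((T * partialP i (partialP i f) x - x.2 i * partialP i f x) * (f x * P.gibbsDensity L T x))) := by
    intro i
    refine (Continuous.integrable_of_hasCompactSupport (by fun_prop) ?_).const_mul _
    exact (((hPPs i).mul_left).sub ((hPs i).mul_left)).mul_right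
  have iX : Integrable (fun x => σ * (liouvilleOp P L f x * (f x * P.gibbsDensity L T x))) := by
    refine Integrable.const_mul ?_ σ
    have : (fun x => liouvilleOp P L f x * (f x * P.gibbsDensity L T x)) =
        fun x => ∑ i, (x.2 i * partialQ i f x - partialQ i (P.hamiltonian L) x * partialP i f x) *
          (f x * P.gibbsDensity L T x) := by
      funext x; simp only [liouvilleOp, Finset.sum_mul]
    rw [this]
    refine integrable_finsetSum _ fun i _ => ?_
    have hH1 : ContDiff ℝ 1 (P.hamiltonian L) := P.contDiff_hamiltonian hU hV L
    have hQc := continuous_partialQ hf1 one_ne_zero i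
    have hWc := P.continuous_partialQ_hamiltonian hH1 i
    refine Continuous.integrable_of_hasCompactSupport (by fun_prop) ?_
    exact (((hasCompactSupport_partialQ hfd hfc i).mul_left (f := fun x : PhaseSpace L => x.2 i)).sub
      ((hPs i).mul_left)).mul_right
  have split : ∫ x, (σ * liouvilleOp P L f x + c * bathOp L B T f x) * (f x * P.gibbsDensity L T x) =
      σ * (∫ x, liouvilleOp P L f x * (f x * P.gibbsDensity L T x)) +
        ∑ i, ∫ x, c * B i *
          ((T * partialP i (partialP i f) x - x.2 i * partialP i f x) * (f x * P.gibbsDensity L T x)) := by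
    rw [← integral_finsetSum _ fun i _ => iS i, ← integral_const_mul,
      ← integral_add iX (integrable_finsetSum _ fun i _ => iS i)]
    refine integral_congr_ae (ae_of_all _ fun x => ?_)
    have e : c * bathOp L B T f x =
        ∑ i, c * B i * (T * partialP i (partialP i f) x - x.2 i * partialP i f x) := by
      unfold bathOp
      rw [Finset.mul_sum]
      exact Finset.sum_congr rfl fun i _ => by ring
    dsimp only
    rw [add_mul, e, Finset.sum_mul]
    congr 1
    · ring
    · exact Finset.sum_congr rfl fun i _ => by ring
  rw [split, hX, mul_zero, zero_add]
  refine Finset.sum_nonpos fun i _ => ?_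
  rw [integral_const_mul, integral_thermo_site_mul P hU hV L hT.ne' i hf hfc hf1]
  have hnn : 0 ≤ ∫ x, partialP i f x * partialP i f x * P.gibbsDensity L T x :=
    integral_nonneg fun x => mul_nonneg (mul_self_nonneg _) (hρpos x).le
  have h1 : -T * ∫ x, partialP i f x * partialP i f x * P.gibbsDensity L T x ≤ 0 := by
    nlinarith
  exact mul_nonpos_of_nonneg_of_nonpos (mul_nonneg hc (hB i)) h1

/-- **Coercivity of `λ − (σ X_H + c S_B)` on `C²_c` in `L²(μ_T)`**: for `λ ≥ 0`,
`λ ∫ ψ² dμ_T ≤ ∫ (λ ψ − σ X_H ψ − c S_B ψ) ψ dμ_T`. [folklore] -/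
theorem integral_resolventOp_mul_self_ge (hU : ContDiff ℝ 1 P.U) (hV : ContDiff ℝ 1 P.V)
    (L : ℕ) {T : ℝ} (hT : 0 < T) (σ : ℝ) {c : ℝ} (hc : 0 ≤ c) {B : Fin L → ℝ} (hB : ∀ i, 0 ≤ B i)
    (lam0 : ℝ) {f : PhaseSpace L → ℝ} (hf : ContDiff ℝ 2 f) (hfc : HasCompactSupport f) :
    lam0 * ∫ x, f x ^ 2 ∂(P.gibbsMeasure L T) ≤
      ∫ x, (lam0 * f x - (σ * liouvilleOp P L f x + c * bathOp L B T f x)) * f x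
        ∂(P.gibbsMeasure L T) := by
  have hρc : Continuous (P.gibbsDensity L T) :=
    P.continuous_gibbsDensity hU.continuous hV.continuous L T
  have hZ : 0 ≤ (∫ x, P.gibbsDensity L T x)⁻¹ :=
    inv_nonneg.2 (integral_nonneg fun x => (P.gibbsDensity_pos L T x).le)
  have hgen := continuous_genOp hU hV L σ c 0 B T hf
  simp only [zero_mul, add_zero] at hgen
  have hf2c : HasCompactSupport (fun x => f x ^ 2 * P.gibbsDensity L T x) := by
    have h : HasCompactSupport (fun x => f x * f x) := hfc.mul_left
    have e : (fun x => f x ^ 2 * P.gibbsDensity L T x) = fun x => (f x * f x) * P.gibbsDensity L T x :=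
      funext fun x => by ring
    rw [e]
    exact h.mul_right
  have i1 : Integrable (fun x => lam0 * (f x ^ 2 * P.gibbsDensity L T x)) :=
    (Continuous.integrable_of_hasCompactSupport (by fun_prop) hf2c).const_mul _
  have i2 : Integrable (fun x => (σ * liouvilleOp P L f x + c * bathOp L B T f x) *
      (f x * P.gibbsDensity L T x)) :=
    Continuous.integrable_of_hasCompactSupport (hgen.mul (hf.continuous.mul hρc))
      hfc.mul_right.mul_left
  rw [P.integral_gibbsMeasure, P.integral_gibbsMeasure, ← mul_assoc, mul_comm lam0, mul_assoc]
  refine mul_le_mul_of_nonneg_left ?_ hZ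
  have e : ∫ x, (lam0 * f x - (σ * liouvilleOp P L f x + c * bathOp L B T f x)) * f x *
      P.gibbsDensity L T x = (∫ x, lam0 * (f x ^ 2 * P.gibbsDensity L T x)) -
        ∫ x, (σ * liouvilleOp P L f x + c * bathOp L B T f x) * (f x * P.gibbsDensity L T x) := by
    rw [← integral_sub i1 i2]
    exact integral_congr_ae (ae_of_all _ fun x => by ring)
  rw [e, integral_const_mul]
  have := integral_genOp_mul_self_density_nonpos P hU hV L hT σ hc hB hf hfc
  linarith

end Dissipative

/-- Registered helper sub-goal `helper_dffCoercive` of stub `stub_deviceForwardFields`: coercivity of `λ − (σ X_H + c S_B)` on `C²_c` (= `integral_resolventOp_mul_self_ge` in stub form). [folklore] -/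
theorem helper_dffCoercive : ∀ (P : OscillatorChain), ContDiff ℝ 1 P.U → ContDiff ℝ 1 P.V → ∀ (L : ℕ) (T : ℝ), 0 < T → ∀ (σ c : ℝ), 0 ≤ c → ∀ (B : Fin L → ℝ), (∀ i, 0 ≤ B i) → ∀ (lam0 : ℝ) (f : PhaseSpace L → ℝ), ContDiff ℝ 2 f → HasCompactSupport f → lam0 * ∫ x, f x ^ 2 ∂(P.gibbsMeasure L T) ≤ ∫ x, (lam0 * f x - (σ * Summit.AtomisticToContinuum.FouriersLaw.Theorems.SuperadditiveResistance.DeviceLiouville.liouvilleOp P L f x + c * Summit.AtomisticToContinuum.FouriersLaw.Theorems.SuperadditiveResistance.DeviceLiouville.bathOp L B T f x)) * f x ∂(P.gibbsMeasure L T) :=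
  fun P hU hV L _ hT σ _ hc _ hB lam0 _ hf hfc => integral_resolventOp_mul_self_ge P hU hV L hT σ hc hB lam0 hf hfc

end Summit.AtomisticToContinuum.FouriersLaw.Cruxes.SuperadditiveResistance.FloatingProbeBypassLaplacian

end
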